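import Literature.Computability.QuantumComplexity.BQP
import Literature.Computability.QuantumComplexity.ClassicalClasses
import Literature.Computability.QuantumComplexity.CountingSimulation
import Literature.Computability.Complexity.Counting
import Literature.Computability.Complexity.ProbabilisticClassesProofs
import HarnessLib

/-!
# Barrier catalogue `QuantumAdvantage`: an unconditional separation must separate `P` from `PP` (Bernstein–Vazirani 1997, §1)

D-0021 barrier entry for the summit `QuantumAdvantage`
(`Summits/QuantumAdvantage/QuantumAdvantage/Statement.lean`:
`QuantumAdvantage := ∃ L, L ∈ BQP ∧ L ∉ BPP`).

**The printed result.** Bernstein–Vazirani, *Quantum complexity theory*, SIAM J. Comput. 26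
(1997), §1, p. 1414: "The class BQP of languages that are efficiently decidable (with small
error-probability) on a quantum Turing machine satisfies `BPP ⊆ BQP ⊆ P^{#P}`. This rules out
the possibility of giving a mathematical proof that quantum Turing machines are more powerful
than classical probabilistic Turing machines (in the unrelativized setting) unless there is a
major breakthrough in complexity theory." The inclusions are their Thm. 8.3 (`BPP ⊆ BQP`),
Thm. 8.6 (`BQP ⊆ P^{#P}`) and Thm. 8.4 (`BQP ⊆ PSPACE`); Adleman–DeMarrais–Huang 1997 sharpen
`BQP ⊆ P^{#P}` to `BQP ⊆ PP` (tree fact `Literature.Computability.QuantumComplexity.BQP_subset_PP`).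

**What this file adds.** The formal content of the quotation, PROVED from tree facts: any witness
`L ∈ BQP ∖ BPP` lies in `PP ∖ BPP`, so the summit implies `PP ⊄ BPP`, `P ≠ PP`, `P ≠ P^{#P}`
and `P ≠ PSPACE` (`SeparationPrerequisites`, `SeparationPrerequisites.of_facts`). The facts used
are `BQP_subset_PP` (Adleman–DeMarrais–Huang), `PP_subset_PSharpP`, `PP_subset_PSPACE` (Gill) —
named facts of the tree, taken as hypotheses — and the discharged `P_subset_BPP_holds`.

**Barrier audit 2026-08-16 (refuter, unit `barrier-audit-QuantumAdvantage-SeparationPrerequisites`):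
CONFIRMED, and sharpened.** The fact is an unconditional theorem of the tree
(`SeparationPrerequisites_holds` in the sibling `SeparationPrerequisitesProofs.lean`, axioms
`propext, Classical.choice, Quot.sound`), so it cannot be refuted; the audit found no literature
evading it for the summit's uniform decision classes and added (append-only): (i) the SHARPER
FLOOR of Fortnow–Rogers 1999 — `BQP ⊆ AWPP` (Thm. 3.1), `AWPP` low for `PP` (Thm. 3.3, Li), §1:
"Showing the containment strict would require separating BPP and PSPACE" — as the theorems
`not_AWPP_subset_BPP_of_witness`, `BPP_ne_AWPP_of_witness`, `BPP_ne_PP_of_witness`,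
`BPP_ne_PSharpP_of_witness`, `BPP_ne_PSPACE_of_witness` and the assembly
`SeparationPrerequisites.sharp_of_facts` (hypotheses: the named facts `BQP_subset_AWPP`,
`BQP_subset_PP`, `PP_subset_PSharpP`, `PP_subset_PSPACE`, all discharged elsewhere in the tree);
(ii) sharpened `because:` / `evasions_known:` / `scope_caveats:` lines of the block below (the
amplitude caveat of Adleman–DeMarrais–Huang Thm. 5.1; the floor is an implication on CONCLUSIONS,
not an obstruction to a technique; the catalogue of unconditional quantum-over-classical
separations, all in models whose classical side has information-theoretic lower bounds, or by
computability). No statement was changed.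

## Sources (locators verified with `lit read` on the held copy)

* E. Bernstein, U. Vazirani, SIAM J. Comput. 26 (1997) 1411–1473 [BernsteinVazirani1997SICOMP]
  (held: `paper:doi-10-1145-167088-167097`): §1 p. 1414 (quotation), Thm. 8.3, 8.4 (p. 1451),
  Thm. 8.6 (p. 1452), §8.4 p. 1455.
* L. Adleman, J. DeMarrais, M.-D. Huang, *Quantum computability*, SIAM J. Comput. 26 (1997)
  1524–1540 (held: `paper:doi-10-1137-s0097539795293639`): Thm. 6.4 p. 1534 (`BQP_{poly(1/ε)},
  EQP_ℂ, NQP ⊆ PP ⊆ P^{#P}`) — through the tree fact `BQP_subset_PP`; Thm. 5.1 p. 1531 (`BQP_ℂ`,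
  unrestricted amplitudes, has sets of every Turing degree) [AdlemanDeMarraisHuang1997].
* L. Fortnow, J. Rogers, *Complexity limitations on quantum computation*, J. Comput. System Sci.
  59 (1999) 240–252 (held: `paper:arxiv-cs_9811023`): §1 (quotation above), Thm. 3.1
  (`BQP ⊆ AWPP`), Thm. 3.3 (`PP^{AWPP} = PP`), Cor. 3.5, Cor. 3.7, Thm. 4.1–4.4 [FortnowRogers1999].
* S. Bravyi, D. Gosset, R. König, *Quantum advantage with shallow circuits*, Science 362 (2018)
  308–311, Thm. 1 — through the tree's `Literature/Computability/QuantumComplexity/ShallowCircuits.lean`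
  [BravyiGossetKonig2018].
* Evasion catalogue (restricted / information-theoretic models; locators verified on the arXiv
  texts): Watts–Kothari–Schaeffer–Tal, STOC 2019, Thm. 1 [WattsEtAl2019]; Grewal–Kumar 2024,
  §1.2.2 [GrewalKumar2024]; Gavinsky–Kempe–Kerenidis–Raz–de Wolf, STOC 2007, §1 and Thm. 2
  [GavinskyEtAl2006]; Ambainis–Watrous, TCS 287 (2002), Thm. 1 and Thm. 5 [AmbainisWatrous1999];
  Huang–Kueng–Preskill, PRL 126 (2021), abstract [HuangKuengPreskill2021]; Ji–Natarajan–Vidick–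
  Wright–Yuen, `MIP* = RE`, §1 [JiEtAl2020]; Raz–Tal, J. ACM 69 (2022) [RazTalJACM2022];
  Aaronson–Ambainis, SIAM J. Comput. 47 (2018) [AaronsonAmbainis2018].
-/

noncomputable section

namespace Literature.Barriers.QuantumAdvantage

open _root_.Computability Literature.Computability.Complexity Literature.Computability.Complexity.Classes Literature.Computability.Cryptography Literature.Computability.QuantumComplexity

/-! ### The proved implications -/

/-- A witness of the summit is a witness of `PP ⊄ BPP` (given `BQP ⊆ PP`).
[cite: BernsteinVazirani1997SICOMP, §1 p. 1414 and Thm. 8.6] -/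
theorem not_PP_subset_BPP_of_witness (hPP : BQP_subset_PP)
    (h : ∃ L : Language Bool, L ∈ BQP ∧ L ∉ BPP) : ¬ PP ⊆ BPP := by
  obtain ⟨L, hL, hLB⟩ := h
  exact fun hsub => hLB (hsub (hPP hL))

/-- Hence `P ≠ PP` (as `P ⊆ BPP`, the discharged tree fact `P_subset_BPP_holds`).
[cite: BernsteinVazirani1997SICOMP, §1 p. 1414] -/
theorem P_ne_PP_of_witness (hPP : BQP_subset_PP)
    (h : ∃ L : Language Bool, L ∈ BQP ∧ L ∉ BPP) : P ≠ PP := by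
  intro hP
  exact not_PP_subset_BPP_of_witness hPP h (hP ▸ P_subset_BPP_holds)

/-- Hence `P ≠ P^{#P}` (given `PP ⊆ P^{#P}`). [cite: BernsteinVazirani1997SICOMP, §1 p. 1414 and Thm. 8.6 (BQP ⊆ P^{#P})] -/
theorem P_ne_PSharpP_of_witness (hPP : BQP_subset_PP) (hSP : PP_subset_PSharpP)
    (h : ∃ L : Language Bool, L ∈ BQP ∧ L ∉ BPP) : P ≠ PSharpP := by
  intro hP
  refine not_PP_subset_BPP_of_witness hPP h fun L hL => ?_
  have hLP : L ∈ P := hP ▸ hSP hL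
  exact P_subset_BPP_holds hLP

/-- Hence `P ≠ PSPACE` (given `PP ⊆ PSPACE`). [cite: BernsteinVazirani1997SICOMP, §1 p. 1414 and Thm. 8.4 (BQP ⊆ PSPACE)] -/
theorem P_ne_PSPACE_of_witness (hPP : BQP_subset_PP) (hPS : PP_subset_PSPACE)
    (h : ∃ L : Language Bool, L ∈ BQP ∧ L ∉ BPP) : P ≠ PSPACE := by
  intro hP
  refine not_PP_subset_BPP_of_witness hPP h fun L hL => ?_
  have hLP : L ∈ P := hP ▸ hPS hL
  exact P_subset_BPP_holds hLP

/-! ### The sharper floor (Fortnow–Rogers 1999): the witness separates `BPP` from `AWPP`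

Barrier audit 2026-08-16. Fortnow–Rogers improve `BQP ⊆ PP` to `BQP ⊆ AWPP` (Thm. 3.1), a class
LOW for `PP` (Thm. 3.3, Li), and state the floor with `BPP` in place of `P`: "Showing the
containment strict would require separating BPP and PSPACE" (§1). Formally every conjunct of
`SeparationPrerequisites` has a `BPP`-version needing NO inclusion `P ⊆ BPP`, and a new, strictly
sharper first conjunct `AWPP ⊄ BPP` (tree fact `BQP_subset_AWPP`, discharged as
`BQP_subset_AWPP_holds` in `QuantumComplexity/BQPSubsetAWPP.lean`; here a hypothesis, to keep this
entry light). -/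

/-- A witness of the summit is a witness of `AWPP ⊄ BPP` (given `BQP ⊆ AWPP`): the sharpest
classical floor in print. [cite: FortnowRogers1999, Thm. 3.1 and §1] -/
theorem not_AWPP_subset_BPP_of_witness (hAW : BQP_subset_AWPP)
    (h : ∃ L : Language Bool, L ∈ BQP ∧ L ∉ BPP) : ¬ AWPP ⊆ BPP := by
  obtain ⟨L, hL, hLB⟩ := h
  exact fun hsub => hLB (hsub (hAW hL))

/-- Hence `BPP ≠ AWPP` (given `BQP ⊆ AWPP`). [cite: FortnowRogers1999, Thm. 3.1 and §1] -/
theorem BPP_ne_AWPP_of_witness (hAW : BQP_subset_AWPP)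
    (h : ∃ L : Language Bool, L ∈ BQP ∧ L ∉ BPP) : BPP ≠ AWPP :=
  fun hB => not_AWPP_subset_BPP_of_witness hAW h hB.symm.subset

/-- `BPP ≠ PP` from a witness (given `BQP ⊆ PP`; no `P ⊆ BPP` needed).
[cite: FortnowRogers1999, §1 and Cor. 3.5] -/
theorem BPP_ne_PP_of_witness (hPP : BQP_subset_PP)
    (h : ∃ L : Language Bool, L ∈ BQP ∧ L ∉ BPP) : BPP ≠ PP :=
  fun hB => not_PP_subset_BPP_of_witness hPP h hB.symm.subset

/-- `BPP ≠ P^{#P}` from a witness (given `BQP ⊆ PP ⊆ P^{#P}`).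
[cite: FortnowRogers1999, §1 and Cor. 3.5] -/
theorem BPP_ne_PSharpP_of_witness (hPP : BQP_subset_PP) (hSP : PP_subset_PSharpP)
    (h : ∃ L : Language Bool, L ∈ BQP ∧ L ∉ BPP) : BPP ≠ PSharpP := by
  obtain ⟨L, hL, hLB⟩ := h
  exact fun hB => hLB (hB ▸ hSP (hPP hL))

/-- `BPP ≠ PSPACE` from a witness (given `BQP ⊆ PP ⊆ PSPACE`): Fortnow–Rogers' wording of the
floor, "separating BPP and PSPACE". [cite: FortnowRogers1999, §1 and Cor. 3.5] -/
theorem BPP_ne_PSPACE_of_witness (hPP : BQP_subset_PP) (hPS : PP_subset_PSPACE)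
    (h : ∃ L : Language Bool, L ∈ BQP ∧ L ∉ BPP) : BPP ≠ PSPACE := by
  obtain ⟨L, hL, hLB⟩ := h
  exact fun hB => hLB (hB ▸ hPS (hPP hL))

/-! ### The barrier fact -/

/-- **An unconditional proof of the summit separates `P` from `PP`, `P^{#P}` and `PSPACE`**
(Bernstein–Vazirani 1997, §1 p. 1414, formal content). PROVED below from the tree facts
(`SeparationPrerequisites.of_facts`).

BARRIER
technique_class: unconditional, class-separation, lower-bound, any technique not separating P from PP, P-versus-PSPACE
blocks: every unconditional proof of the summit `QuantumAdvantage` (`∃ L ∈ BQP, L ∉ BPP`) that is not at the same time a proof of `PP ⊄ BPP`, of `P ≠ PP`, of `P ≠ P^{#P}` and of `P ≠ PSPACE` — there is none, since the summit implies all four (`SeparationPrerequisites.of_facts`, proved; components `not_PP_subset_BPP_of_witness`, `P_ne_PP_of_witness`, `P_ne_PSharpP_of_witness`, `P_ne_PSPACE_of_witness`); the same applies to the stronger theses of routes `AvgCase` (average-case hardness of a `BQP` language) and `CircuitLB` (`BQP ⊄ P/poly`), which imply the summit.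
because: `BPP ⊆ BQP ⊆ P^{#P} ⊆ PSPACE` [cite: BernsteinVazirani1997SICOMP, Thm. 8.3, Thm. 8.6 and Thm. 8.4, pp. 1451–1452], sharpened to `BQP ⊆ PP` (Adleman–DeMarrais–Huang; tree fact `BQP_subset_PP`), so a language in `BQP ∖ BPP` is a language in `PP ∖ BPP ⊆ PSPACE ∖ P`; "This rules out the possibility of giving a mathematical proof that quantum Turing machines are more powerful than classical probabilistic Turing machines (in the unrelativized setting) unless there is a major breakthrough in complexity theory" [cite: BernsteinVazirani1997SICOMP, §1 p. 1414]; sharper (audit 2026-08-16): `BQP ⊆ AWPP ⊆ PP` with `AWPP` low for `PP` [cite: FortnowRogers1999, Thm. 3.1, Thm. 3.3 and Cor. 3.5] (tree facts `BQP_subset_AWPP`, `AWPP_subset_PP`, both discharged), so the witness even lies in `AWPP ∖ BPP` and the summit implies `AWPP ⊄ BPP`, `BPP ≠ AWPP`, `BPP ≠ PP`, `BPP ≠ P^{#P}`, `BPP ≠ PSPACE` with no use of `P ⊆ BPP` (`SeparationPrerequisites.sharp_of_facts`): "Showing the containment strict would require separating BPP and PSPACE, a presumably difficult task" [cite: FortnowRogers1999,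 §1].
evasions_known: conditional separations (the summit from `FACTORING ∉ BPP` or `DLOG ∉ BPP` via Shor's algorithm; routes `Shor`, `AvgCase`) [cite: BernsteinVazirani1997SICOMP, §1 p. 1414 (Shor's algorithms for factoring and discrete log)]; relativized separations, which are theorems (`BQP^O ⊄ BPP^O` by recursive Fourier sampling; Simon) but concern oracle machines [cite: BernsteinVazirani1997SICOMP, Thm. 8.10, Cor. 8.14 and §8.4 p. 1455]; unconditional separations in restricted models that do not contain `P`, e.g. constant-depth bounded-fan-in quantum circuits solve the 2D Hidden Linear Function problem while classical bounded-fan-in probabilistic circuits need depth `Ω(log n)` (tree statement quantum-advantage.S23) [cite: BravyiGossetKonig2018, Thm. 1]; more generally (audit 2026-08-16) EVERY unconditional quantum-over-classical separation in print lives in a model whose classical side admits information-theoretic lower bounds and which does not contain `BPP`, so none meets the floor and none proves the summit — black-box / query complexity (Bernstein–Vazirani, Simon, Forrelation) and the circuit separations descending from it — relation problems in `QNC⁰` against `NC⁰`, `AC⁰` and `GC⁰(k)`, in `QNC⁰/qpoly` or interactive `QNC⁰` against `AC⁰[p]` and `GC⁰(k)[p]`, and the promise problem `BQLOGTIME ⊄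 AC⁰` (Bravyi–Gosset–König; Watts–Kothari–Schaeffer–Tal: the 2D HLF problem is not solved by `AC⁰` circuits of depth `d` and size `exp(n^{1/10d})` [cite: WattsEtAl2019, Thm. 1]; Le Gall, Coudron–Stark–Vidick, Grier–Schaeffer, Bravyi–Gosset–König–Tomamichel, Raz–Tal, Grewal–Kumar — "even showing that P is strictly contained in PSPACE is currently beyond the reach of complexity theory … yet another option is to look at restricted models of computation" [cite: GrewalKumar2024, §1.2.2]), one-way and two-way communication complexity ("one of the few areas where one can establish unconditional exponential separations", `O(log n)` qubits against `Ω(√n)` classical bits [cite: GavinskyEtAl2006, §1 and Thm. 2]), two-way finite automata (a 2qcfa recognises palindromes, which no 2pfa does, and `{aⁿbⁿ}` in polynomial expected time, where 2pfa's need exponential time [cite: AmbainisWatrous1999, Thm. 1 and Thm. 5]), and the sample complexity of learning from quantum experiments [cite: HuangKuengPreskill2021, abstract]; the one unconditional quantum-over-classical separation of classes with polynomial-time VERIFIERS that contain `P` is by computability, not by a lower bound — `MIP* = RE ⊋ NEXP = MIP` (entangled provers; no bearing on `BQP`) [cite: JiEtAl2020, §1].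
scope_caveats: only the implications are printed and proved; "major breakthrough" is the authors' informal gloss and no claim of unprovability is made [cite: BernsteinVazirani1997SICOMP, §1 p. 1414]; the floor is an implication between CONCLUSIONS and forbids no technique by itself — the technique-level obstructions to its right-hand sides are the sibling entries `Relativization` (`P^A = PSPACE^A` for a `PSPACE`-complete `A`), `Algebrization` and, for the `P/poly` forms, `NaturalProofs` (audit 2026-08-16); the converse fails to be known (neither `P ≠ PSPACE` nor `P ≠ PP` nor `BPP ≠ AWPP` is known to imply the summit); the inclusions `BQP ⊆ PP`, `PP ⊆ P^{#P}`, `PP ⊆ PSPACE` (and `BQP ⊆ AWPP` for the sharper floor `SeparationPrerequisites.sharp_of_facts`) enter as the tree's named facts (hypotheses of `of_facts`), only `P ⊆ BPP` is discharged here (`P_subset_BPP_holds`) — all of them are discharged elsewhere in the tree and fed in by `SeparationPrerequisitesProofs.lean` (`SeparationPrerequisites_holds`); classes are the tree's (`BQP` = uniform Clifford+T, `BPP = bp P`, `PP`, `AWPP` in Fenner's one-`GapP`-function form, `PSharpP = P^{#P}` via function oracles, `PSPACE`); the floor needs computable amplitudes: `BQP ⊆ PP` is printed for poly-time approximable (in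 particular algebraic, e.g. Clifford+T) amplitudes [cite: AdlemanDeMarraisHuang1997, Thm. 6.4], while over a gate set with unrestricted complex amplitudes `BQP_ℂ` has sets of every Turing degree [cite: AdlemanDeMarraisHuang1997, Thm. 5.1], so `BQP_ℂ ⊄ BPP` is a vacuous theorem and the floor is void there — excluded in-tree by the `polyTimeComputableComplex` hypothesis of `BQPOver_eq_BQP` (quantum-advantage.S26).
status: established (theorem; proved here from the tree facts) [cite: BernsteinVazirani1997SICOMP, §1 p. 1414, Thm. 8.4, Thm. 8.6] -/
def SeparationPrerequisites : Prop :=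
  (∃ L : Language Bool, L ∈ BQP ∧ L ∉ BPP) → ¬ PP ⊆ BPP ∧ P ≠ PP ∧ P ≠ PSharpP ∧ P ≠ PSPACE

/-- `SeparationPrerequisites` from the tree facts `BQP ⊆ PP`, `PP ⊆ P^{#P}`, `PP ⊆ PSPACE`.
[cite: BernsteinVazirani1997SICOMP, §1 p. 1414] -/
theorem SeparationPrerequisites.of_facts (hPP : BQP_subset_PP) (hSP : PP_subset_PSharpP)
    (hPS : PP_subset_PSPACE) : SeparationPrerequisites :=
  fun h => ⟨not_PP_subset_BPP_of_witness hPP h, P_ne_PP_of_witness hPP h,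
    P_ne_PSharpP_of_witness hPP hSP h, P_ne_PSPACE_of_witness hPP hPS h⟩

/-- Contrapositive reading: in any world where `P = PSPACE` the summit is false (given the
facts). [cite: BernsteinVazirani1997SICOMP, §1 p. 1414] -/
theorem not_summit_of_P_eq_PSPACE (hPP : BQP_subset_PP) (hPS : PP_subset_PSPACE)
    (hP : P = PSPACE) : ¬ ∃ L : Language Bool, L ∈ BQP ∧ L ∉ BPP :=
  fun h => P_ne_PSPACE_of_witness hPP hPS h hP

/-! ### The sharper floor, assembled (barrier audit 2026-08-16) -/

/-- **The sharper floor** (Fortnow–Rogers 1999): a witness of the summit separates `BPP` from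
`AWPP`, `PP`, `P^{#P}` and `PSPACE` — from the named facts `BQP ⊆ AWPP`, `BQP ⊆ PP`, `PP ⊆ P^{#P}`,
`PP ⊆ PSPACE` (all discharged in the tree; fed in by `SeparationPrerequisitesProofs.lean`) and
WITHOUT `P ⊆ BPP`. Strictly sharper than `SeparationPrerequisites` conjunct by conjunct
(`AWPP ⊆ PP`, `P ⊆ BPP`). [cite: FortnowRogers1999, §1, Thm. 3.1 and Cor. 3.5] -/
theorem SeparationPrerequisites.sharp_of_facts (hAW : BQP_subset_AWPP) (hPP : BQP_subset_PP)
    (hSP : PP_subset_PSharpP) (hPS : PP_subset_PSPACE) :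
    (∃ L : Language Bool, L ∈ BQP ∧ L ∉ BPP) →
      ¬ AWPP ⊆ BPP ∧ BPP ≠ AWPP ∧ BPP ≠ PP ∧ BPP ≠ PSharpP ∧ BPP ≠ PSPACE :=
  fun h => ⟨not_AWPP_subset_BPP_of_witness hAW h, BPP_ne_AWPP_of_witness hAW h,
    BPP_ne_PP_of_witness hPP h, BPP_ne_PSharpP_of_witness hPP hSP h,
    BPP_ne_PSPACE_of_witness hPP hPS h⟩

/-- Contrapositive of the sharper floor: in any world where `AWPP ⊆ BPP` the summit is false
(given `BQP ⊆ AWPP`). [cite: FortnowRogers1999, Thm. 3.1] -/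
theorem not_summit_of_AWPP_subset_BPP (hAW : BQP_subset_AWPP) (h : AWPP ⊆ BPP) :
    ¬ ∃ L : Language Bool, L ∈ BQP ∧ L ∉ BPP :=
  fun hw => not_AWPP_subset_BPP_of_witness hAW hw h

end Literature.Barriers.QuantumAdvantage

end
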